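import Mathlib
import Literature.NumberTheory.Irrationality.Lai2025TwoAdic.GeneralDerivativeExpansionA
import Literature.NumberTheory.Irrationality.Lai2025TwoAdic.GeneralTwoAdicValuation
import HarnessLib

/-!
# Lai 2025 (IJNT, `2`-adic zeta values), §6 for GENERAL `s`, the `A`-family, part 2: Lemma 6.2 —
# the exact `2`-adic valuation of `S_n` along `n = 2^m − 1` (`m ≥ 2`), hence `S_n ≠ 0` — PROVED

Topic `Literature/NumberTheory/Irrationality/Lai2025TwoAdic`.  Source: L. Lai, *On the irrationality of certain
`2`-adic zeta values*, Int. J. Number Theory (2025) = arXiv:2304.00816 [Lai2025TwoAdicZeta], §6, Lemma 6.2 and its proof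
(held text `paper:arxiv-2304.00816`, chunks p0011–p0012, read on the page).  PROOF FILE (definitions with bodies +
theorems; no named fact, net debt 0); file 4b of the groundwork for the tree's named fact
`PAdicZetaValues.lai2025TwoAdic_theorem12`.  The `A`-twin of `GeneralTwoAdicValuation.lean` (B-family, Lemma 6.3),
whose Lemma 6.1 (`norm_Ffac_le_half`), Lucas lemma (`norm_choose_mersenne`), binomial comparison
(`norm_choose_mul_half_pow_le`), integer coefficients `coefN`/`cdom`/`iotaDom` and `Δ`-calculus (`LipNat`, `LipNatMod`,
`norm_sub_volkenbornSum_le_of_lipNatMod`) are reused; the Leibniz data come from `GeneralDerivativeExpansionA.lean`.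

## Source, as printed ([Lai2025TwoAdicZeta, §6])

**Lemma 6.2.** «For any integer `n` of the form `n = 2^m − 1` with `m ≥ 2`, we have
`v₂(Φ_n^{−s−2}d_n^{3s+5}S_n) = (10s+20)n + (s+2)m + 2s + v₂((s+2)!) + 2`.  In particular, `Φ_n^{−s−2}d_n^{3s+5}S_n ≠ 0`
and `|Φ_n^{−s−2}d_n^{3s+5}S_n|₂ = 2^{(−10s−20+o(1))n}` as `n = 2^m − 1 → ∞`.»
*Proof.* «Obviously `v₂(Φ_n) = 0` and `v₂(d_n) = m−1`.  It suffices to prove that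
`v₂(S_n) = (10s+20)n − (2s+3)m + 5s + v₂((s+2)!) + 7`.  Note that `A_n(t+¼) = 2^{(9s+18)n+4s+8}·f(t)` … it suffices to
prove that `v₂(∫_{ℤ₂}f^{(s)}(t)dt) = (s+2)n − (2s+3)m + s + v₂((s+2)!) − 1` (eqn_2-adic-order-esti). … We will show that
the term corresponding to the index `(0,…,0,i_{2^{m−1}} = s,0,…,0)` in (eqn_Sum) dominates … (eqn_dominating_term)
`v₂(∫f_{(0,…,0,i_{2^{m−1}}=s,0,…,0)}) = (s+2)n − (2s+3)m + s + v₂((s+2)!) − 1`, and (eqn_other_terms)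
`v₂(∫f_{(i_1,…,i_n,j)}) ≥ (s+2)n − (2s+3)m + s + v₂((s+2)!)` for any other index. … Clearly, we can express `g(t)` as a
power series `g(t) = Σ c_kt^k`, where `c_k ∈ 2^kℤ₂` … `Δ_m(g^{(j)}/j!) ≥ Δ(g^{(j)}/j!) ≥ 0` (eqn_5_2) … By Lemma 2.5 (3),
`Δ_m(binom(t+2^m−1,2^m−1)²) ≥ −m+2`, `Δ_m(binom(t+2^{m−1}−1,2^{m−1}−1)) ≥ −m+2`, `Δ_m(binom(t+2^m−1,2^{m−1}−1)) ≥ −m+2`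
… Therefore, Lemma 2.4 implies that `∫(…) ≡ 2^{−m}Σ_{k<2^m}(…)(k) (mod 2^{−m+1}ℤ₂)`.  Note that `binom(k+2^m−1,2^m−1)` is
even for `1 ≤ k ≤ 2^m−1` by either Kummer's or Lucas' theorem and `g(0) ≡ 1 (mod 2ℤ₂)`.  We obtain `∫(…) ∈ 2^{−m}+2^{−m+1}ℤ₂`
… At last, we prove (eqn_other_terms) … `Δ(g^{(j)}/j!·binom(t+n,n)^{2+j}∏binom^{i_k}binom^{i_k}) ≥ −m+1` … it suffices
to show `v₂(s!binom(s+2,i_1)⋯binom(s+2,i_n)n!^{2+j}∏((k−1)!(n−k)!)^{i_k}) ≥ (s+2)n − (2s+2)m + s + v₂((s+2)!)` … By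
Lemma 6.1 … `≥ (2+j)(n−m) + (i_1+⋯+i_n)(n−2m+2) − i_* = (2+j)(m−2) + (i_1+⋯+i_n+j+2)(n−2m+2) − i_*
≥ 2(m−2) + (s+2)(n−2m+2) − i_*` … `u ≥ v₂((u+2)(u+1))`.»

## What is formalised (all PROVED; `n = 2^m − 1`, `m ≥ 2`)

* The `g`-part at the naturals in `ℚ₂`: `GA2 s δ n c j = 𝒟_cg(j)` with `GA2_eq` (explicit), **(eqn_5_2)** in Lipschitz
  form `lipNat_GA2` (`Δ(g^{(j)}/j!) ≥ 0`, `ℤ₂`-valued: every factor of the expansion is an odd integer, a slope `2, 4`,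
  or `(−4)^λ(4j+4a+1)^{−λ−1}`), and «`g(0) ≡ 1 (mod 2)`» as `norm_GA2_zero_zero`.
* The terms `PhiA2 = PhiBin2 · GA2` of (eqn_Sum) in `ℚ₂`, `DAs_natCast_eq_sumA`
  (`A_n^{(s)}(j+¼) = s!·2^{(9s+18)n+4s+8}Σ_{(i,ι)} coefN·PhiA2(j)`), their Lipschitz data (`lipNat_PhiA2`: `Δ ≥ −m+1`;
  `lipNatMod_PhiA2_dom`: `Δ_m ≥ −m+2` at the dominating index), values (`norm_PhiA2_le_quarter` for `1 ≤ j < 2^m`,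
  `norm_PhiA2_dom_zero = 1`).
* **The coefficient domination with the `g`-part kept whole:** `norm_coefN_le_half` — `‖coefN_{(i,ι)}‖₂ ≤ ½‖coef_dom‖₂`
  off the dominating index, using the source's full count `v₂(n!^{2+j}) = (2+j)(n−m)` (here as
  `norm_factorial_le_half_norm_Ffac`: `‖n!‖₂ ≤ ½‖(k₀−1)!(n−k₀)!‖₂`, i.e. `v₂(n!) − v₂(F_{k₀}) = m−1 ≥ 1`) instead of the
  B-twin's `4^{−j}` from the expanded `g^{(j)}`.
* **Lemma 6.2:** `norm_Ss_mersenne` — `‖S_n‖₂ = ‖s!·2^{(9s+18)n+4s+8}·coef_dom‖₂·2^m` (the printed valuation, with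
  `v₂(coef_dom) = v₂(binom(s+2,s)) + 2v₂(n!) + s·v₂((k₀−1)!(n−k₀)!)`), `Ss_mersenne_ne_zero` (**`S_n ≠ 0`**), and the smallness
  bound `norm_Ss_mersenne_le` (`‖S_n‖₂ ≤ 2^{(2s+3)m − (10s+20)n − 5s − 8}`; printed `|…S_n|₂ = 2^{(−10s−20+o(1))n}`).
  DEVIATION (flagged, as in the B-twin): the valuation is proved as an exact NORM identity by integrating the normalised sum
  `Ψ = Σ(coef/coef_dom)·PhiA2` at once (`Δ_m(Ψ) ≥ −m+2`, unit Riemann sum at level `m`).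

Cell zeta5-irr / pub-zeta5 (HONEST FRAMING: systematic search; no irrationality claim unless kernel-certified):
`2`-adic valuation of linear forms in `1, ζ₂(j,¼)`; nothing here bears on `ζ(5) ∈ ℝ`.
-/

noncomputable section

open Finset Filter Topology
open Literature.NumberTheory.LocalFields
open Literature.NumberTheory.Irrationality.PAdicZetaValues
open Literature.NumberTheory.Irrationality.LaiSprangZudilin2026 (norm_natCast_eq_two_zpow norm_factorial_eq
  norm_two_pow norm_factorial_le)
open Literature.Analysis.Calculus
open scoped Nat

namespace Literature.NumberTheory.Irrationality.Lai2025TwoAdic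

/-! ## §1. The `g`-part at the naturals in `ℚ₂`: (eqn_5_2) in Lipschitz form, and `g(0) ≡ 1 (mod 2)` -/

/-- `‖a‖₂ ≤ 1` for a natural number `a`. [folklore] -/
private theorem norm_natCast_le_one₂ (a : ℕ) : ‖(a : ℚ_[2])‖ ≤ 1 := by
  have := Padic.norm_int_le_one (p := 2) (a : ℤ)
  rwa [Int.cast_natCast] at this

/-- Finite sums of `ℤ₂`-valued functions are `ℤ₂`-valued (ultrametric). [folklore] -/
private theorem bddNat_finset_sum {ι : Type*} (S : Finset ι) {F : ι → ℕ → ℚ_[2]} (h : ∀ x ∈ S, BddNat 2 (F x)) :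
    BddNat 2 (fun k => ∑ x ∈ S, F x k) := fun k =>
  IsUltrametricDist.norm_sum_le_of_forall_le_of_nonneg zero_le_one fun x hx => h x hx k

/-- The divided derivatives of a linear factor of `g` at a natural `j`, in `ℚ₂`. [cite: Lai2025TwoAdicZeta, Lemma 6.2 (proof: "c_k ∈ 2^kℤ₂")] -/
def dLin2 (n : ℕ) (γ : ℕ × ℕ) (μ : ℕ) (j : ℕ) : ℚ_[2] :=
  if μ = 0 then (linSlope n γ : ℚ_[2]) * j + (linShift n γ : ℚ_[2]) else if μ = 1 then (linSlope n γ : ℚ_[2]) else 0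

/-- `dLin` casts to `dLin2`. [cite: Lai2025TwoAdicZeta, Lemma 6.2 (proof)] -/
theorem dLin_cast (n : ℕ) (γ : ℕ × ℕ) (μ j : ℕ) : ((dLin n γ μ j : ℚ) : ℚ_[2]) = dLin2 n γ μ j := by
  unfold dLin dLin2 linFac
  split_ifs <;> push_cast <;> rfl

/-- The slopes `2, 4` have `‖·‖₂ ≤ ½`. [cite: Lai2025TwoAdicZeta, Lemma 6.2 (proof: "c_k ∈ 2^kℤ₂")] -/
theorem norm_linSlope_le (n : ℕ) (γ : ℕ × ℕ) : ‖(linSlope n γ : ℚ_[2])‖ ≤ 2⁻¹ := by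
  have h2 : ‖(2 : ℚ_[2])‖ = 2⁻¹ := by
    have := Padic.norm_p (p := 2); push_cast at this; exact this
  unfold linSlope
  split_ifs <;> push_cast
  · rw [show (4 : ℚ_[2]) = 2 ^ 2 by norm_num, norm_pow, h2]; norm_num
  · rw [h2]

/-- The constant terms `2n+1`, `2k+1` are `2`-adic units. [cite: Lai2025TwoAdicZeta, Lemma 6.2 (proof: "g(0) ≡ 1 (mod 2ℤ₂)")] -/
theorem norm_linShift (n : ℕ) (γ : ℕ × ℕ) : ‖(linShift n γ : ℚ_[2])‖ = 1 := by
  refine norm_natCast_of_not_dvd (p := 2) ?_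
  unfold linShift
  split_ifs <;> omega

/-- **Each divided derivative of a linear factor is `ℤ₂`-valued with `Δ ≥ 0`.** [cite: Lai2025TwoAdicZeta, Lemma 6.2 (proof: (eqn_5_2))] -/
theorem lipNat_dLin2 (n : ℕ) (γ : ℕ × ℕ) (μ : ℕ) : LipNat 2 1 (dLin2 n γ μ) ∧ BddNat 2 (dLin2 n γ μ) := by
  have hs1 : ‖(linSlope n γ : ℚ_[2])‖ ≤ 1 := (norm_linSlope_le n γ).trans (by norm_num)
  by_cases h0 : μ = 0
  · have e : dLin2 n γ μ = fun j : ℕ => (linSlope n γ : ℚ_[2]) * j + (linShift n γ : ℚ_[2]) := by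
      funext j; simp [dLin2, h0]
    rw [e]
    exact ⟨(lipNat_linear (p := 2) _ _).mono hs1, bddNat_linear (p := 2) hs1 (norm_linShift n γ).le⟩
  by_cases h1 : μ = 1
  · have e : dLin2 n γ μ = fun _ : ℕ => (linSlope n γ : ℚ_[2]) := by funext j; simp [dLin2, h1]
    rw [e]
    exact ⟨(LipNat.const (p := 2) _).mono zero_le_one, fun _ => hs1⟩
  · have e : dLin2 n γ μ = fun _ : ℕ => (0 : ℚ_[2]) := by funext j; simp [dLin2, h0, h1]
    rw [e]
    exact ⟨(LipNat.const (p := 2) _).mono zero_le_one, fun _ => by simp⟩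

/-- `𝒟_c g` at a natural `j`, in `ℚ₂` (the source's `g^{(j)}(t)/j!` on the naturals). [cite: Lai2025TwoAdicZeta, Lemma 6.2 (proof: (eqn_5_2))] -/
def GA2 (s δ n c j : ℕ) : ℚ_[2] := ((GAq s δ n c j : ℚ) : ℚ_[2])

/-- The linear-block part at a natural `j` in `ℚ₂`. [cite: Lai2025TwoAdicZeta, Lemma 6.2 (proof)] -/
def linPart2 (s δ n b j : ℕ) : ℚ_[2] := ∑ μ ∈ (linIdx s δ n).piAntidiag b, ∏ γ ∈ linIdx s δ n, dLin2 n γ (μ γ) j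

/-- The inverse-block part at a natural `j` in `ℚ₂`: `Σ_λ ∏_α (−4)^{λ_α}(4j+4a+1)^{−(λ_α+1)}` (tree `vq a j = (4j+4a+1)^{−1}`).
[cite: Lai2025TwoAdicZeta, Lemma 6.2 (proof: the factors of g^{(j)}/j!)] -/
def invPart2 (s n c j : ℕ) : ℚ_[2] :=
  ∑ lam ∈ (invIdx (2 * s + 2) n).piAntidiag c, ∏ α ∈ invIdx (2 * s + 2) n, (-4 : ℚ_[2]) ^ lam α * vq α.1 j ^ (lam α + 1)

/-- **`𝒟_c g(j)` in `ℚ₂`, explicitly:** `GA2 c j = Σ_{b ≤ c} linPart2(b)(j) · invPart2(c−b)(j)`. [cite: Lai2025TwoAdicZeta, Lemma 6.2 (proof: (eqn_5_2))] -/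
theorem GA2_eq (s δ n c j : ℕ) :
    GA2 s δ n c j = ∑ b ∈ range (c + 1), linPart2 s δ n b j * invPart2 s n (c - b) j := by
  have hx : ∀ a ∈ range (n + 1), 4 * (j : ℚ) + 4 * (a : ℚ) + 1 ≠ 0 := fun a _ => by positivity
  rw [GA2, GAq_eq s δ n c hx]
  push_cast
  refine sum_congr rfl fun b _ => ?_
  congr 1
  · rw [linPart2]
    refine sum_congr rfl fun μ _ => prod_congr rfl fun γ _ => dLin_cast n γ (μ γ) j
  · rw [invPart2]
    refine sum_congr rfl fun lam _ => prod_congr rfl fun α _ => ?_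
    rw [vq, inv_pow]
    push_cast
    ring

/-- `‖(−4)^λ‖₂ ≤ 1`. [folklore] -/
private theorem norm_neg_four_pow_le (e : ℕ) : ‖(-4 : ℚ_[2]) ^ e‖ ≤ 1 := by
  rw [norm_pow, norm_neg]
  refine pow_le_one₀ (norm_nonneg _) ?_
  have := norm_natCast_le_one₂ 4
  push_cast at this
  exact this

/-- The linear-block part is `ℤ₂`-valued with `Δ ≥ 0`. [cite: Lai2025TwoAdicZeta, Lemma 6.2 (proof: (eqn_5_2))] -/
theorem lipNat_linPart2 (s δ n b : ℕ) : LipNat 2 1 (linPart2 s δ n b) ∧ BddNat 2 (linPart2 s δ n b) := by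
  have hM : (0 : ℝ) ≤ 1 := zero_le_one
  have hprod : ∀ μ ∈ (linIdx s δ n).piAntidiag b,
      LipNat 2 1 (fun j => ∏ γ ∈ linIdx s δ n, dLin2 n γ (μ γ) j) ∧
        BddNat 2 (fun j => ∏ γ ∈ linIdx s δ n, dLin2 n γ (μ γ) j) := fun μ _ =>
    ⟨LipNat.finset_prod _ hM (fun γ _ => (lipNat_dLin2 n γ (μ γ)).1) (fun γ _ => (lipNat_dLin2 n γ (μ γ)).2),
      BddNat.finset_prod _ fun γ _ => (lipNat_dLin2 n γ (μ γ)).2⟩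
  exact ⟨LipNat.finset_sum _ hM fun μ hμ => (hprod μ hμ).1, bddNat_finset_sum _ fun μ hμ => (hprod μ hμ).2⟩

/-- The inverse-block part is `ℤ₂`-valued with `Δ ≥ 0` (each `(4j+4a+1)^{−1}` has `Δ ≥ 2`). [cite: Lai2025TwoAdicZeta, Lemma 6.2 (proof: (eqn_5_2))] -/
theorem lipNat_invPart2 (s n c : ℕ) : LipNat 2 1 (invPart2 s n c) ∧ BddNat 2 (invPart2 s n c) := by
  have hM : (0 : ℝ) ≤ 1 := zero_le_one
  have h4 : ‖(4 : ℚ_[2])‖ ≤ 1 := by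
    have := norm_natCast_le_one₂ 4; push_cast at this; exact this
  have hfac : ∀ (a e : ℕ) (c' : ℚ_[2]), ‖c'‖ ≤ 1 →
      LipNat 2 1 (fun j => c' * vq a j ^ e) ∧ BddNat 2 (fun j => c' * vq a j ^ e) := by
    intro a e c' hc'
    have hv := lipNat_vq a
    have hp : LipNat 2 1 (fun j => vq a j ^ e) := (hv.1.mono h4).pow hv.2 hM e
    have hb : BddNat 2 (fun j => vq a j ^ e) := hv.2.pow e
    refine ⟨((hp.const_mul c').mono ?_), fun j => ?_⟩
    · calc ‖c'‖ * 1 ≤ 1 * 1 := by gcongr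
        _ = 1 := one_mul _
    · rw [norm_mul]; exact mul_le_one₀ hc' (norm_nonneg _) (hb j)
  have hprod : ∀ lam ∈ (invIdx (2 * s + 2) n).piAntidiag c,
      LipNat 2 1 (fun j => ∏ α ∈ invIdx (2 * s + 2) n, (-4 : ℚ_[2]) ^ lam α * vq α.1 j ^ (lam α + 1)) ∧
        BddNat 2 (fun j => ∏ α ∈ invIdx (2 * s + 2) n, (-4 : ℚ_[2]) ^ lam α * vq α.1 j ^ (lam α + 1)) := by
    intro lam _
    have hf := fun α (_ : α ∈ invIdx (2 * s + 2) n) =>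
      hfac α.1 (lam α + 1) ((-4 : ℚ_[2]) ^ lam α) (norm_neg_four_pow_le _)
    exact ⟨LipNat.finset_prod _ hM (fun α hα => (hf α hα).1) (fun α hα => (hf α hα).2),
      BddNat.finset_prod _ fun α hα => (hf α hα).2⟩
  exact ⟨LipNat.finset_sum _ hM fun lam hl => (hprod lam hl).1, bddNat_finset_sum _ fun lam hl => (hprod lam hl).2⟩

/-- **(eqn_5_2) in Lipschitz form:** `𝒟_c g` is `ℤ₂`-valued on the naturals with `Δ ≥ 0`
(«`Δ_m(g^{(j)}/j!) ≥ Δ(g^{(j)}/j!) ≥ 0` for every `j ≥ 0`»). [cite: Lai2025TwoAdicZeta, Lemma 6.2 (proof: (eqn_5_2))] -/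
theorem lipNat_GA2 (s δ n c : ℕ) : LipNat 2 1 (GA2 s δ n c) ∧ BddNat 2 (GA2 s δ n c) := by
  have hM : (0 : ℝ) ≤ 1 := zero_le_one
  have e : GA2 s δ n c = fun j => ∑ b ∈ range (c + 1), linPart2 s δ n b j * invPart2 s n (c - b) j :=
    funext (GA2_eq s δ n c)
  rw [e]
  have hterm : ∀ b ∈ range (c + 1), LipNat 2 1 (fun j => linPart2 s δ n b j * invPart2 s n (c - b) j) ∧
      BddNat 2 (fun j => linPart2 s δ n b j * invPart2 s n (c - b) j) := fun b _ =>
    ⟨(lipNat_linPart2 s δ n b).1.mul' (lipNat_invPart2 s n (c - b)).1 (lipNat_linPart2 s δ n b).2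
      (lipNat_invPart2 s n (c - b)).2, (lipNat_linPart2 s δ n b).2.mul (lipNat_invPart2 s n (c - b)).2⟩
  exact ⟨LipNat.finset_sum _ hM fun b hb => (hterm b hb).1, bddNat_finset_sum _ fun b hb => (hterm b hb).2⟩

/-- **«`g(0) ≡ 1 (mod 2ℤ₂)`»:** `‖𝒟_0 g(0)‖₂ = ‖g(0)‖₂ = 1` (a product of odd integers and inverses of odd integers).
[cite: Lai2025TwoAdicZeta, Lemma 6.2 (proof of (eqn_5_1): "g(0) ≡ 1 (mod 2ℤ₂)")] -/
theorem norm_GA2_zero_zero (s δ n : ℕ) : ‖GA2 s δ n 0 0‖ = 1 := by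
  rw [GA2_eq, sum_range_one, Nat.sub_zero, linPart2, invPart2, piAntidiag_zero, piAntidiag_zero, sum_singleton,
    sum_singleton, norm_mul, norm_prod, norm_prod]
  have h1 : ∀ γ ∈ linIdx s δ n, ‖dLin2 n γ ((0 : (ℕ × ℕ) → ℕ) γ) 0‖ = 1 := fun γ _ => by
    simp only [Pi.zero_apply, dLin2, if_true, Nat.cast_zero, mul_zero, zero_add]
    exact norm_linShift n γ
  have h2 : ∀ α ∈ invIdx (2 * s + 2) n, ‖(-4 : ℚ_[2]) ^ ((0 : (ℕ × ℕ) → ℕ) α) * vq α.1 0 ^ ((0 : (ℕ × ℕ) → ℕ) α + 1)‖ = 1 :=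
    fun α _ => by simp only [Pi.zero_apply, pow_zero, one_mul, zero_add, pow_one]; exact norm_vq _ _
  rw [prod_eq_one h1, prod_eq_one h2, one_mul]

/-! ## §2. The terms of (eqn_Sum) in `ℚ₂`: `coefN · PhiBin2(j) · 𝒟_{s−i}g(j)` -/

/-- The binomial part `PhiBinQ` in `ℚ₂`. [cite: Lai2025TwoAdicZeta, Lemma 6.2 (proof: f_{(i_1,…,i_n,j)})] -/
def PhiBin2 (s n i : ℕ) (ι : ℕ → ℕ) (j : ℕ) : ℚ_[2] :=
  Cb n n j ^ (s + 2 - i) * ∏ k ∈ Icc 1 n, (Cb (k - 1) (k - 1) j * Cb n (n - k) j) ^ ι k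

/-- `PhiBinQ` casts to `PhiBin2`. [cite: Lai2025TwoAdicZeta, Lemma 6.2 (proof)] -/
theorem PhiBinQ_cast (s n i : ℕ) (ι : ℕ → ℕ) (j : ℕ) : ((PhiBinQ s n i ι j : ℚ) : ℚ_[2]) = PhiBin2 s n i ι j := by
  simp only [PhiBinQ, PhiBin2, Cb]
  push_cast
  rfl

/-- **The function part of the term `(i, ι)`:** `PhiA2 = PhiBin2 · 𝒟_{s−i}g` at the naturals (the source's
`g^{(j)}/j!·binom(t+n,n)^{2+j}∏_k(binom(t+k−1,k−1)binom(t+n,n−k))^{i_k}` up to the integer coefficient).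
[cite: Lai2025TwoAdicZeta, Lemma 6.2 (proof: f_{(i_1,…,i_n,j)})] -/
def PhiA2 (s δ n i : ℕ) (ι : ℕ → ℕ) (j : ℕ) : ℚ_[2] := PhiBin2 s n i ι j * GA2 s δ n (s - i) j

/-- **(eqn_Sum) for the `2`-adic integrand:** `A_n^{(s)}(j+¼) = s!·2^{(9s+18)n+4s+8}·Σ_{(i,ι)} coefN·PhiA2(j)` in `ℚ₂` at
every natural `j` (`δ ≤ 1`). [cite: Lai2025TwoAdicZeta, Lemma 6.2 (proof: (eqn_Sum))] -/
theorem DAs_natCast_eq_sumA (s : ℕ) {δ : ℕ} (hδ : δ ≤ 1) (n j : ℕ) :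
    DAs s δ n (j : ℤ_[2]) = ((s ! : ℕ) : ℚ_[2]) * 2 ^ ((9 * s + 18) * n + 4 * s + 8) *
      ∑ i ∈ range (s + 1), ∑ ι ∈ (Icc 1 n).piAntidiag i,
        ((coefN s n i ι : ℕ) : ℚ_[2]) * PhiA2 s δ n i ι j := by
  rw [DAs_natCast, DAsq_natCast_eq_sum s hδ]
  push_cast
  simp only [PhiBinQ_cast, PhiA2, GA2]

/-! ## §3. The Lipschitz data and the values of the function parts (`n = 2^m − 1`) -/

/-- `1 ≤ 2^e` in `ℝ`. [folklore] -/
private theorem one_le_two_pow_real (e : ℕ) : (1 : ℝ) ≤ (2 : ℝ) ^ e := one_le_pow₀ one_le_two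

/-- The binomial part is `ℤ₂`-valued with `Δ ≥ −m+1` (`n = 2^m − 1`; Lemma 2.5 (1) for `binom(t+n,n)`, `binom(t+k−1,k−1)`,
`binom(t+n,n−k)`). [cite: Lai2025TwoAdicZeta, Lemma 6.2 (proof of (eqn_other_terms): "Δ(…) ≥ −m+1")] -/
theorem lipNat_PhiBin2 (s m i : ℕ) (ι : ℕ → ℕ) :
    LipNat 2 ((2 : ℝ) ^ (m - 1)) (PhiBin2 s (2 ^ m - 1) i ι) ∧ BddNat 2 (PhiBin2 s (2 ^ m - 1) i ι) := by
  have hM : (0 : ℝ) ≤ (2 : ℝ) ^ (m - 1) := by positivity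
  have h2m : 1 ≤ 2 ^ m := Nat.one_le_two_pow
  have hC : ∀ c r : ℕ, r ≤ 2 ^ m - 1 → LipNat 2 ((2 : ℝ) ^ (m - 1)) (Cb c r) := fun c r hr =>
    lipNat_Cb_of_lt (by omega)
  have b1 : BddNat 2 (fun j => Cb (2 ^ m - 1) (2 ^ m - 1) j ^ (s + 2 - i)) := (bddNat_Cb _ _).pow _
  have l1 : LipNat 2 ((2 : ℝ) ^ (m - 1)) (fun j => Cb (2 ^ m - 1) (2 ^ m - 1) j ^ (s + 2 - i)) :=
    (hC _ _ le_rfl).pow (bddNat_Cb _ _) hM _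
  have b2k : ∀ k ∈ Icc 1 (2 ^ m - 1),
      BddNat 2 (fun j => (Cb (k - 1) (k - 1) j * Cb (2 ^ m - 1) (2 ^ m - 1 - k) j) ^ ι k) := fun k _ =>
    ((bddNat_Cb _ _).mul (bddNat_Cb _ _)).pow _
  have l2k : ∀ k ∈ Icc 1 (2 ^ m - 1), LipNat 2 ((2 : ℝ) ^ (m - 1))
      (fun j => (Cb (k - 1) (k - 1) j * Cb (2 ^ m - 1) (2 ^ m - 1 - k) j) ^ ι k) := by
    intro k hk
    have hk' := mem_Icc.1 hk
    exact ((hC _ _ (by omega)).mul' (hC _ _ (by omega)) (bddNat_Cb _ _) (bddNat_Cb _ _)).pow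
      ((bddNat_Cb _ _).mul (bddNat_Cb _ _)) hM _
  have b2 : BddNat 2
      (fun j => ∏ k ∈ Icc 1 (2 ^ m - 1), (Cb (k - 1) (k - 1) j * Cb (2 ^ m - 1) (2 ^ m - 1 - k) j) ^ ι k) :=
    BddNat.finset_prod _ b2k
  have l2 : LipNat 2 ((2 : ℝ) ^ (m - 1))
      (fun j => ∏ k ∈ Icc 1 (2 ^ m - 1), (Cb (k - 1) (k - 1) j * Cb (2 ^ m - 1) (2 ^ m - 1 - k) j) ^ ι k) :=
    LipNat.finset_prod _ hM l2k b2k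
  exact ⟨l1.mul' l2 b1 b2, b1.mul b2⟩

/-- **(eqn_other_terms), function part:** every `PhiA2_{(i,ι)}` is `ℤ₂`-valued with `Δ ≥ −m+1`. [cite: Lai2025TwoAdicZeta, Lemma 6.2 (proof of (eqn_other_terms))] -/
theorem lipNat_PhiA2 (s δ m i : ℕ) (ι : ℕ → ℕ) :
    LipNat 2 ((2 : ℝ) ^ (m - 1)) (PhiA2 s δ (2 ^ m - 1) i ι) ∧ BddNat 2 (PhiA2 s δ (2 ^ m - 1) i ι) := by
  have hB := lipNat_PhiBin2 s m i ι
  have hG := lipNat_GA2 s δ (2 ^ m - 1) (s - i)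
  exact ⟨hB.1.mul' (hG.1.mono (one_le_two_pow_real _)) hB.2 hG.2, hB.2.mul hG.2⟩

/-- The dominating function part: `PhiA2_dom(j) = binom(j+n,n)²·(binom(j+k₀−1,k₀−1)·binom(j+n,n−k₀))^s·g(j)`.
[cite: Lai2025TwoAdicZeta, Lemma 6.2 (proof: the display for f_{(0,…,0,i_{2^{m−1}}=s,0,…,0)})] -/
theorem PhiA2_dom_eq (s δ : ℕ) {m : ℕ} (hm : 1 ≤ m) (j : ℕ) :
    PhiA2 s δ (2 ^ m - 1) s (iotaDom s m) j = Cq (2 ^ m - 1) j ^ 2 *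
      (Cb (2 ^ (m - 1) - 1) (2 ^ (m - 1) - 1) j * Cb (2 ^ m - 1) (2 ^ m - 1 - 2 ^ (m - 1)) j) ^ s *
      GA2 s δ (2 ^ m - 1) 0 j := by
  rw [PhiA2, PhiBin2, show s + 2 - s = 2 by omega, Nat.sub_self,
    prod_eq_single_of_mem _ (two_pow_pred_mem_Icc hm) (fun k _ hk => by rw [iotaDom_apply_of_ne s m hk, pow_zero]),
    iotaDom_apply_self]
  simp only [Cq, Cb]

/-- `⌊log₂(2^m − 1)⌋ = m − 1` (`m ≥ 1`). [folklore] -/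
private theorem log_two_mersenne' {m : ℕ} (hm : 1 ≤ m) : Nat.log 2 (2 ^ m - 1) = m - 1 := by
  have h2m : 2 ^ m = 2 * 2 ^ (m - 1) := by rw [← pow_succ']; congr 1; omega
  have hk1 : 1 ≤ 2 ^ (m - 1) := Nat.one_le_two_pow
  refine Nat.log_eq_of_pow_le_of_lt_pow (by omega) ?_
  rw [show m - 1 + 1 = m by omega]; omega

/-- **(eqn_dominating_term), function part:** `Δ_m(PhiA2_dom) ≥ −m+2` (Lemma 2.5 (3) for `binom(t+2^m−1,2^m−1)²`, Lemma 2.5 (1)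
for the two other binomials and for `g`, then Lemma 2.5 (2)). [cite: Lai2025TwoAdicZeta, Lemma 6.2 (proof of (eqn_dominating_term): "Δ_m(…) ≥ −m+2")] -/
theorem lipNatMod_PhiA2_dom (s δ : ℕ) {m : ℕ} (hm : 2 ≤ m) :
    LipNatMod 2 m ((2 : ℝ) ^ (m - 2)) (PhiA2 s δ (2 ^ m - 1) s (iotaDom s m)) := by
  have hm1 : 1 ≤ m := by omega
  have h2m : 2 ^ m = 2 * 2 ^ (m - 1) := by rw [← pow_succ']; congr 1; omega
  have hk2 : 2 ≤ 2 ^ (m - 1) := by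
    have : 2 ^ 1 ≤ 2 ^ (m - 1) := Nat.pow_le_pow_right (by norm_num) (by omega)
    simpa using this
  have hM : (0 : ℝ) ≤ (2 : ℝ) ^ (m - 2) := by positivity
  have e : PhiA2 s δ (2 ^ m - 1) s (iotaDom s m) = fun j => Cq (2 ^ m - 1) j ^ 2 *
      (Cb (2 ^ (m - 1) - 1) (2 ^ (m - 1) - 1) j * Cb (2 ^ m - 1) (2 ^ m - 1 - 2 ^ (m - 1)) j) ^ s *
      GA2 s δ (2 ^ m - 1) 0 j := funext (PhiA2_dom_eq s δ hm1)
  rw [e]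
  have h1 : LipNatMod 2 m ((2 : ℝ) ^ (m - 2)) (fun j => Cq (2 ^ m - 1) j ^ 2) := by
    have h := lipNatMod_Cq_sq (n := 2 ^ m - 1) hm1 (by omega)
    rw [log_two_mersenne' hm1] at h
    refine h.mono (le_of_eq ?_)
    rw [show m - 1 = (m - 2) + 1 by omega, pow_succ]; ring
  have hr : 2 ^ m - 1 - 2 ^ (m - 1) = 2 ^ (m - 1) - 1 := by omega
  have hC : LipNat 2 ((2 : ℝ) ^ (m - 2)) (Cb (2 ^ (m - 1) - 1) (2 ^ (m - 1) - 1)) := by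
    have := lipNat_Cb_of_lt (c := 2 ^ (m - 1) - 1) (r := 2 ^ (m - 1) - 1) (m := m - 1) (by omega)
    rwa [show m - 1 - 1 = m - 2 by omega] at this
  have hC' : LipNat 2 ((2 : ℝ) ^ (m - 2)) (Cb (2 ^ m - 1) (2 ^ m - 1 - 2 ^ (m - 1))) := by
    rw [hr]
    have := lipNat_Cb_of_lt (c := 2 ^ m - 1) (r := 2 ^ (m - 1) - 1) (m := m - 1) (by omega)
    rwa [show m - 1 - 1 = m - 2 by omega] at this
  have b1 : BddNat 2 (fun j => Cq (2 ^ m - 1) j ^ 2) :=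
    (BddNat.natCast (p := 2) fun j => (j + (2 ^ m - 1)).choose (2 ^ m - 1)).pow 2
  have b2 : BddNat 2 (fun j =>
      (Cb (2 ^ (m - 1) - 1) (2 ^ (m - 1) - 1) j * Cb (2 ^ m - 1) (2 ^ m - 1 - 2 ^ (m - 1)) j) ^ s) :=
    ((bddNat_Cb _ _).mul (bddNat_Cb _ _)).pow _
  have l2 : LipNat 2 ((2 : ℝ) ^ (m - 2)) (fun j =>
      (Cb (2 ^ (m - 1) - 1) (2 ^ (m - 1) - 1) j * Cb (2 ^ m - 1) (2 ^ m - 1 - 2 ^ (m - 1)) j) ^ s) :=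
    (hC.mul' hC' (bddNat_Cb _ _) (bddNat_Cb _ _)).pow ((bddNat_Cb _ _).mul (bddNat_Cb _ _)) hM _
  have hG := lipNat_GA2 s δ (2 ^ m - 1) 0
  have l3 : LipNat 2 ((2 : ℝ) ^ (m - 2)) (GA2 s δ (2 ^ m - 1) 0) := hG.1.mono (one_le_two_pow_real _)
  have h12 := h1.mul (lipNatMod_of_lipNat l2 m) b1 b2
  have h123 := h12.mul (lipNatMod_of_lipNat l3 m) (b1.mul b2) hG.2
  rw [max_self, max_self] at h123
  exact h123

/-- `‖binom‖₂ ≤ 1`. [folklore] -/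
private theorem norm_Cb_le_one' (c r j : ℕ) : ‖Cb c r j‖ ≤ 1 := norm_natCast_le_one₂ _

/-- The middle block is `ℤ₂`-valued. [cite: Lai2025TwoAdicZeta, Lemma 6.2 (proof)] -/
private theorem norm_prod_Cb_pow_le_one' (n : ℕ) (ι : ℕ → ℕ) (j : ℕ) :
    ‖∏ k ∈ Icc 1 n, (Cb (k - 1) (k - 1) j * Cb n (n - k) j) ^ ι k‖ ≤ 1 := by
  rw [norm_prod]
  refine prod_le_one (fun _ _ => norm_nonneg _) fun k _ => ?_
  rw [norm_pow, norm_mul]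
  exact pow_le_one₀ (by positivity) (mul_le_one₀ (norm_Cb_le_one' _ _ _) (norm_nonneg _) (norm_Cb_le_one' _ _ _))

/-- Every `PhiA2` is `ℤ₂`-valued at the naturals. [cite: Lai2025TwoAdicZeta, Lemma 6.2 (proof)] -/
theorem norm_PhiA2_le_one (s δ n i : ℕ) (ι : ℕ → ℕ) (j : ℕ) : ‖PhiA2 s δ n i ι j‖ ≤ 1 := by
  rw [PhiA2, PhiBin2, norm_mul, norm_mul]
  refine mul_le_one₀ (mul_le_one₀ ?_ (norm_nonneg _) (norm_prod_Cb_pow_le_one' n ι j)) (norm_nonneg _)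
    ((lipNat_GA2 s δ n (s - i)).2 j)
  rw [norm_pow]; exact pow_le_one₀ (norm_nonneg _) (norm_Cb_le_one' _ _ _)

/-- **The terms `k ≥ 1` of the Riemann sum:** `‖PhiA2(j)‖₂ ≤ ¼` for `1 ≤ j < 2^m` (`n = 2^m − 1`, `i ≤ s`): the factor
`binom(j+n,n)^{s+2−i}` with «`binom(k+2^m−1,2^m−1)` even for `1 ≤ k ≤ 2^m−1`» and `s+2−i ≥ 2`.
[cite: Lai2025TwoAdicZeta, Lemma 6.2 (proof of (eqn_5_1))] -/
theorem norm_PhiA2_le_quarter (s δ : ℕ) {m : ℕ} (hm : 1 ≤ m) {i : ℕ} (hi : i ≤ s) (ι : ℕ → ℕ)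
    {j : ℕ} (hj1 : 1 ≤ j) (hj : j < 2 ^ m) : ‖PhiA2 s δ (2 ^ m - 1) i ι j‖ ≤ 4⁻¹ := by
  rw [PhiA2, PhiBin2, norm_mul, norm_mul]
  have hC : ‖Cb (2 ^ m - 1) (2 ^ m - 1) j‖ ≤ 2⁻¹ := norm_Cq_le_half hm hj1 hj
  have h1 : ‖Cb (2 ^ m - 1) (2 ^ m - 1) j ^ (s + 2 - i)‖ ≤ 4⁻¹ := by
    rw [norm_pow]
    calc ‖Cb (2 ^ m - 1) (2 ^ m - 1) j‖ ^ (s + 2 - i) ≤ ‖Cb (2 ^ m - 1) (2 ^ m - 1) j‖ ^ 2 :=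
          pow_le_pow_of_le_one (norm_nonneg _) (norm_Cb_le_one' _ _ _) (by omega)
      _ ≤ (2⁻¹ : ℝ) ^ 2 := pow_le_pow_left₀ (norm_nonneg _) hC 2
      _ = 4⁻¹ := by norm_num
  calc ‖Cb (2 ^ m - 1) (2 ^ m - 1) j ^ (s + 2 - i)‖ *
        ‖∏ k ∈ Icc 1 (2 ^ m - 1), (Cb (k - 1) (k - 1) j * Cb (2 ^ m - 1) (2 ^ m - 1 - k) j) ^ ι k‖ *
        ‖GA2 s δ (2 ^ m - 1) (s - i) j‖
      ≤ 4⁻¹ * 1 * 1 := by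
        refine mul_le_mul (mul_le_mul h1 (norm_prod_Cb_pow_le_one' _ ι j) (norm_nonneg _) (by norm_num))
          ((lipNat_GA2 s δ (2 ^ m - 1) (s - i)).2 j) (norm_nonneg _) (by norm_num)
    _ = 4⁻¹ := by ring

/-- **The term `k = 0` of the Riemann sum:** `‖PhiA2_dom(0)‖₂ = 1` (`binom(n,n) = binom(k₀−1,k₀−1) = 1`, `binom(2^m−1,·)` odd,
«`g(0) ≡ 1 (mod 2ℤ₂)`»). [cite: Lai2025TwoAdicZeta, Lemma 6.2 (proof of (eqn_5_1))] -/
theorem norm_PhiA2_dom_zero (s δ : ℕ) {m : ℕ} (hm : 1 ≤ m) : ‖PhiA2 s δ (2 ^ m - 1) s (iotaDom s m) 0‖ = 1 := by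
  rw [PhiA2_dom_eq s δ hm, norm_mul, norm_mul, norm_GA2_zero_zero]
  have e1 : Cq (2 ^ m - 1) 0 = 1 := by simp [Cq]
  have e2 : Cb (2 ^ (m - 1) - 1) (2 ^ (m - 1) - 1) 0 = 1 := by simp [Cb]
  have e4 : ‖Cb (2 ^ m - 1) (2 ^ m - 1 - 2 ^ (m - 1)) 0‖ = 1 := by
    rw [Cb, zero_add]; exact norm_choose_mersenne (Nat.sub_le _ _)
  rw [e1, e2, one_pow, norm_one, one_mul, mul_one, norm_pow, norm_mul, e4, norm_one, one_mul, one_pow]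

/-! ## §4. The domination of coefficients, `g`-part kept whole: `‖coefN_{(i,ι)}‖₂ ≤ ½‖coef_dom‖₂` off the dominating index -/

/-- **`v₂(n!) ≥ v₂((k₀−1)!(n−k₀)!) + (m−1)`** for `n = 2^m−1`, `k₀ = 2^{m−1}`, `m ≥ 2`, in the form `‖n!‖₂ ≤ ½‖F_{k₀}‖₂`
(`n! = n·(n−1)!`, `n` odd, `(n−1)! = F_{k₀}·binom(n−1,k₀−1)` and `v₂(binom(2^m−2,2^{m−1}−1)) = m−1`) — the source's count
«`v₂(n!^{2+j}…) ≥ (2+j)(n−m) + …`» versus «`v₂((k₀−1)!(n−k₀)!) = n−2m+1`».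
[cite: Lai2025TwoAdicZeta, Lemma 6.2 (proof of (eqn_other_terms): "(2+j)(n−m) + (i_1+⋯+i_n)(n−2m+2) − i_* = (2+j)(m−2) + …")] -/
theorem norm_factorial_le_half_norm_Ffac {m : ℕ} (hm : 2 ≤ m) :
    ‖(((2 ^ m - 1)! : ℕ) : ℚ_[2])‖ ≤ ‖((Ffac (2 ^ m - 1) (2 ^ (m - 1)) : ℕ) : ℚ_[2])‖ / 2 := by
  have hm1 : 1 ≤ m := by omega
  have h2m : 2 ^ m = 2 * 2 ^ (m - 1) := by rw [← pow_succ']; congr 1; omega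
  have hk1 : 1 ≤ 2 ^ (m - 1) := Nat.one_le_two_pow
  have hodd : ¬ 2 ∣ (2 ^ m - 1) := by omega
  have e : (2 ^ m - 1)! = (2 ^ m - 1) * (2 ^ m - 1 - 1)! := by
    conv_lhs => rw [show 2 ^ m - 1 = (2 ^ m - 1 - 1) + 1 by omega]
    rw [Nat.factorial_succ, show 2 ^ m - 1 - 1 + 1 = 2 ^ m - 1 by omega]
  rw [e, Nat.cast_mul, norm_mul, norm_natCast_of_not_dvd (p := 2) hodd, one_mul, norm_Ffac_middle hm,
    le_div_iff₀ two_pos]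
  refine mul_le_mul_of_nonneg_left ?_ (norm_nonneg _)
  rw [zpow_natCast]
  calc (2 : ℝ) = 2 ^ 1 := (pow_one _).symm
    _ ≤ 2 ^ (m - 1) := pow_le_pow_right₀ (by norm_num) (by omega)

/-- **The domination of coefficients, `g`-part kept whole** ((eqn_other_terms), coefficient part): for every index `(i, ι)`
of (eqn_Sum) with `i ≤ s` other than the dominating one (`n = 2^m − 1`, `m ≥ 2`), `‖coefN_{(i,ι)}‖₂ ≤ ½‖coef_dom‖₂` — by
Lemma 6.1 (`∏_k‖F_k‖^{ι_k} ≤ ‖F_{k₀}‖^i 2^{−(i−ι_{k₀})}`), by `‖n!‖^{s+2−i} ≤ ‖n!‖²‖F_{k₀}‖^{s−i}2^{−(s−i)}` (the source's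
`(2+j)(n−m) = (2+j)(m−2) + (2+j)(n−2m+2)`), and «`u ≥ v₂((u+2)(u+1))`» for `u = s − ι_{k₀} ≥ 1`.
[cite: Lai2025TwoAdicZeta, Lemma 6.2 (proof of (eqn_other_terms), (eqn_5_3))] -/
theorem norm_coefN_le_half (s : ℕ) {m : ℕ} (hm : 2 ≤ m) {i : ℕ} (hi : i ≤ s) {ι : ℕ → ℕ}
    (hι : ι ∈ (Icc 1 (2 ^ m - 1)).piAntidiag i) (hne : ¬ (i = s ∧ ι = iotaDom s m)) :
    ‖((coefN s (2 ^ m - 1) i ι : ℕ) : ℚ_[2])‖ ≤ ‖((cdom s m : ℕ) : ℚ_[2])‖ / 2 := by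
  have hm1 : 1 ≤ m := by omega
  have hk0S : 2 ^ (m - 1) ∈ Icc 1 (2 ^ m - 1) := two_pow_pred_mem_Icc hm1
  have hsum : ∑ k ∈ Icc 1 (2 ^ m - 1), ι k = i := (mem_piAntidiag.1 hι).1
  have hsupp : ∀ k, ι k ≠ 0 → k ∈ Icc 1 (2 ^ m - 1) := (mem_piAntidiag.1 hι).2
  have hιle : ι (2 ^ (m - 1)) ≤ i := hsum ▸ single_le_sum (fun _ _ => Nat.zero_le _) hk0S
  -- `ι k₀ < s` off the dominating index
  have hlt : ι (2 ^ (m - 1)) < s := by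
    by_contra h
    apply hne
    refine ⟨by omega, funext fun k => ?_⟩
    by_cases hk : k = 2 ^ (m - 1)
    · rw [hk, iotaDom_apply_self]; omega
    · have hk' : ι k = 0 := by
        by_contra hne0
        have hkS := hsupp k hne0
        have h2 : ι (2 ^ (m - 1)) + ι k ≤ ∑ x ∈ Icc 1 (2 ^ m - 1), ι x := by
          rw [← sum_pair (Ne.symm hk)]
          refine sum_le_sum_of_subset_of_nonneg (fun x hx => ?_) (fun _ _ _ => Nat.zero_le _)
          rw [mem_insert, mem_singleton] at hx
          rcases hx with rfl | rfl
          exacts [hk0S, hkS]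
        omega
      rw [hk', iotaDom_apply_of_ne s m hk]
  rw [norm_coefN, norm_cdom s hm1]
  set A := ‖(((s + 2).choose (ι (2 ^ (m - 1))) : ℕ) : ℚ_[2])‖ with hA
  set N := ‖(((2 ^ m - 1) ! : ℕ) : ℚ_[2])‖ with hN
  set F := ‖((Ffac (2 ^ m - 1) (2 ^ (m - 1)) : ℕ) : ℚ_[2])‖ with hF
  have hA0 : 0 ≤ A := norm_nonneg _
  have hN0 : 0 ≤ N := norm_nonneg _
  have hF0 : 0 ≤ F := norm_nonneg _
  -- (A) the binomials: all are `2`-adic integers, keep the one at `k₀`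
  have hStepA : ∏ k ∈ Icc 1 (2 ^ m - 1), ‖(((s + 2).choose (ι k) : ℕ) : ℚ_[2])‖ ≤ A := by
    rw [← mul_prod_erase _ _ hk0S]
    exact mul_le_of_le_one_right hA0 (prod_le_one (fun _ _ => norm_nonneg _) fun k _ => norm_natCast_le_one₂ _)
  -- (B) `‖n!‖^{s+2−i} ≤ ‖n!‖²(‖F_{k₀}‖/2)^{s−i}`
  have hNF : N ≤ F / 2 := norm_factorial_le_half_norm_Ffac hm
  have hStepB : N ^ (s + 2 - i) ≤ N ^ 2 * (F ^ (s - i) * (2⁻¹ : ℝ) ^ (s - i)) := by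
    rw [show s + 2 - i = 2 + (s - i) by omega, pow_add, ← mul_pow, ← div_eq_mul_inv]
    exact mul_le_mul_of_nonneg_left (pow_le_pow_left₀ hN0 hNF _) (pow_nonneg hN0 _)
  -- (C) Lemma 6.1: `∏_k ‖F_k‖^{ι_k} ≤ ‖F_{k₀}‖^i · 2^{−(i − ι_{k₀})}`
  have hStepC : ∏ k ∈ Icc 1 (2 ^ m - 1), ‖((Ffac (2 ^ m - 1) k : ℕ) : ℚ_[2])‖ ^ ι k ≤
      F ^ i * (2⁻¹ : ℝ) ^ (i - ι (2 ^ (m - 1))) := by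
    rw [← mul_prod_erase _ _ hk0S]
    have hrest : ∏ k ∈ (Icc 1 (2 ^ m - 1)).erase (2 ^ (m - 1)), ‖((Ffac (2 ^ m - 1) k : ℕ) : ℚ_[2])‖ ^ ι k ≤
        ∏ k ∈ (Icc 1 (2 ^ m - 1)).erase (2 ^ (m - 1)), (F * 2⁻¹) ^ ι k := by
      refine prod_le_prod (fun _ _ => pow_nonneg (norm_nonneg _) _) fun k hk => ?_
      have hk' := mem_erase.1 hk
      exact pow_le_pow_left₀ (norm_nonneg _)
        ((norm_Ffac_le_half hm hk'.2 hk'.1).trans_eq (div_eq_mul_inv _ _)) _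
    have hexp : ∑ k ∈ (Icc 1 (2 ^ m - 1)).erase (2 ^ (m - 1)), ι k = i - ι (2 ^ (m - 1)) := by
      have := add_sum_erase _ ι hk0S
      omega
    rw [prod_pow_eq_pow_sum, hexp, mul_pow] at hrest
    calc F ^ ι (2 ^ (m - 1)) * ∏ k ∈ (Icc 1 (2 ^ m - 1)).erase (2 ^ (m - 1)), ‖((Ffac (2 ^ m - 1) k : ℕ) : ℚ_[2])‖ ^ ι k
        ≤ F ^ ι (2 ^ (m - 1)) * (F ^ (i - ι (2 ^ (m - 1))) * (2⁻¹ : ℝ) ^ (i - ι (2 ^ (m - 1)))) :=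
          mul_le_mul_of_nonneg_left hrest (pow_nonneg hF0 _)
      _ = F ^ i * (2⁻¹ : ℝ) ^ (i - ι (2 ^ (m - 1))) := by
          rw [← mul_assoc, ← pow_add, show ι (2 ^ (m - 1)) + (i - ι (2 ^ (m - 1))) = i by omega]
  -- (E) «u ≥ v₂((u+2)(u+1))»
  have hStepE : A * (2⁻¹ : ℝ) ^ (s - ι (2 ^ (m - 1))) ≤ ‖(((s + 2).choose s : ℕ) : ℚ_[2])‖ / 2 := by
    have h := norm_choose_mul_half_pow_le (s := s) (u := s - ι (2 ^ (m - 1))) (by omega) (by omega)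
    rwa [show s - (s - ι (2 ^ (m - 1))) = ι (2 ^ (m - 1)) by omega] at h
  calc (∏ k ∈ Icc 1 (2 ^ m - 1), ‖(((s + 2).choose (ι k) : ℕ) : ℚ_[2])‖) * N ^ (s + 2 - i) *
        (∏ k ∈ Icc 1 (2 ^ m - 1), ‖((Ffac (2 ^ m - 1) k : ℕ) : ℚ_[2])‖ ^ ι k)
      ≤ A * (N ^ 2 * (F ^ (s - i) * (2⁻¹ : ℝ) ^ (s - i))) * (F ^ i * (2⁻¹ : ℝ) ^ (i - ι (2 ^ (m - 1)))) := by
        have h12 := mul_le_mul hStepA hStepB (pow_nonneg hN0 _) hA0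
        exact mul_le_mul h12 hStepC (prod_nonneg fun _ _ => pow_nonneg (norm_nonneg _) _) (mul_nonneg hA0 (by positivity))
    _ = A * (2⁻¹ : ℝ) ^ (s - ι (2 ^ (m - 1))) * (N ^ 2 * F ^ s) := by
        have e1 : F ^ (s - i) * F ^ i = F ^ s := by rw [← pow_add, show s - i + i = s by omega]
        have e2 : (2⁻¹ : ℝ) ^ (s - i) * (2⁻¹ : ℝ) ^ (i - ι (2 ^ (m - 1))) = (2⁻¹ : ℝ) ^ (s - ι (2 ^ (m - 1))) := by
          rw [← pow_add, show s - i + (i - ι (2 ^ (m - 1))) = s - ι (2 ^ (m - 1)) by omega]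
        rw [← e1, ← e2]; ring
    _ ≤ ‖(((s + 2).choose s : ℕ) : ℚ_[2])‖ / 2 * (N ^ 2 * F ^ s) :=
        mul_le_mul_of_nonneg_right hStepE (by positivity)
    _ = ‖(((s + 2).choose s : ℕ) : ℚ_[2])‖ * N ^ 2 * F ^ s / 2 := by ring

/-- For every index (dominating or not) `‖coefN‖₂ ≤ ‖coef_dom‖₂`. [cite: Lai2025TwoAdicZeta, Lemma 6.2 (proof)] -/
theorem norm_coefN_le (s : ℕ) {m : ℕ} (hm : 2 ≤ m) {i : ℕ} (hi : i ≤ s) {ι : ℕ → ℕ}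
    (hι : ι ∈ (Icc 1 (2 ^ m - 1)).piAntidiag i) :
    ‖((coefN s (2 ^ m - 1) i ι : ℕ) : ℚ_[2])‖ ≤ ‖((cdom s m : ℕ) : ℚ_[2])‖ := by
  by_cases hne : i = s ∧ ι = iotaDom s m
  · obtain ⟨rfl, rfl⟩ := hne
    rw [cdom]
  · exact (norm_coefN_le_half s hm hi hι hne).trans (by linarith [norm_nonneg ((cdom s m : ℕ) : ℚ_[2])])

/-! ## §5. Lemma 6.2: the normalised integrand `Ψ = K^{−1}A_n^{(s)}(t+¼)`, `K = s!·2^{(9s+18)n+4s+8}·coef_dom` -/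

/-- The normalised term `(coef/coef_dom)·PhiA2` of (eqn_Sum). [cite: Lai2025TwoAdicZeta, Lemma 6.2 (proof)] -/
def PsiTermA (s δ m i : ℕ) (ι : ℕ → ℕ) (j : ℕ) : ℚ_[2] :=
  ((cdom s m : ℕ) : ℚ_[2])⁻¹ * ((coefN s (2 ^ m - 1) i ι : ℕ) : ℚ_[2]) * PhiA2 s δ (2 ^ m - 1) i ι j

/-- `Ψ(j) := Σ_{(i,ι)} (coef/coef_dom)·PhiA2(j) = f^{(s)}(j)/(s!·coef_dom)` (`n = 2^m − 1`). [cite: Lai2025TwoAdicZeta, Lemma 6.2 (proof: (eqn_Sum))] -/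
def PsiA (s δ m j : ℕ) : ℚ_[2] :=
  ∑ i ∈ range (s + 1), ∑ ι ∈ (Icc 1 (2 ^ m - 1)).piAntidiag i, PsiTermA s δ m i ι j

/-- The normalising constant `K := s!·2^{(9s+18)n+4s+8}·coef_dom`. [cite: Lai2025TwoAdicZeta, Lemma 6.2 (proof: A_n(t+¼) = 2^{(9s+18)n+4s+8}f(t))] -/
def KA (s m : ℕ) : ℚ_[2] :=
  ((s ! : ℕ) : ℚ_[2]) * 2 ^ ((9 * s + 18) * (2 ^ m - 1) + 4 * s + 8) * ((cdom s m : ℕ) : ℚ_[2])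

/-- `K ≠ 0`. [cite: Lai2025TwoAdicZeta, Lemma 6.2 (proof)] -/
theorem KA_ne_zero (s : ℕ) {m : ℕ} (hm : 1 ≤ m) : KA s m ≠ 0 :=
  mul_ne_zero (mul_ne_zero (by exact_mod_cast Nat.factorial_ne_zero s) (pow_ne_zero _ two_ne_zero))
    (by exact_mod_cast cdom_ne_zero s hm)

/-- The normalised integrand `Ψ(t) := K^{−1}·A_n^{(s)}(t+¼)` on `ℤ₂`. [cite: Lai2025TwoAdicZeta, Lemma 6.2 (proof)] -/
def FzA (s δ m : ℕ) (t : ℤ_[2]) : ℚ_[2] := (KA s m)⁻¹ * DAs s δ (2 ^ m - 1) t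

/-- `Ψ` at the naturals is the double sum `PsiA` (`δ ≤ 1`). [cite: Lai2025TwoAdicZeta, Lemma 6.2 (proof: (eqn_Sum))] -/
theorem FzA_natCast (s : ℕ) {δ : ℕ} (hδ : δ ≤ 1) {m : ℕ} (hm : 1 ≤ m) (j : ℕ) :
    FzA s δ m (j : ℤ_[2]) = PsiA s δ m j := by
  have hc : ((cdom s m : ℕ) : ℚ_[2]) ≠ 0 := by exact_mod_cast cdom_ne_zero s hm
  have hs : ((s ! : ℕ) : ℚ_[2]) ≠ 0 := by exact_mod_cast Nat.factorial_ne_zero s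
  have e : ∀ S : ℚ_[2], (KA s m)⁻¹ * (((s ! : ℕ) : ℚ_[2]) * 2 ^ ((9 * s + 18) * (2 ^ m - 1) + 4 * s + 8) * S) =
      ((cdom s m : ℕ) : ℚ_[2])⁻¹ * S := fun S => by
    rw [KA]; field_simp
  rw [FzA, DAs_natCast_eq_sumA s hδ, e, PsiA, mul_sum]
  refine sum_congr rfl fun i _ => ?_
  rw [mul_sum]
  refine sum_congr rfl fun ι _ => ?_
  rw [PsiTermA, mul_assoc]

/-- The Riemann sums of `Ψ` tend to `K^{−1}·S_n`. [cite: Lai2025TwoAdicZeta, Definition 3.2 / Lemma 6.2 (proof)] -/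
theorem tendsto_volkenbornSum_FzA (s : ℕ) {δ : ℕ} (hδ : δ ≤ 1) (m : ℕ) :
    Tendsto (volkenbornSum 2 (FzA s δ m)) atTop (𝓝 ((KA s m)⁻¹ * Ss s δ (2 ^ m - 1))) := by
  refine ((tendsto_volkenbornSum_DAs_Ss s hδ (2 ^ m - 1)).const_mul (KA s m)⁻¹).congr fun N => ?_
  rw [← smul_eq_mul, ← volkenbornSum_smul]
  rfl

/-- Each normalised term has `Δ_m ≥ −m+2`: the dominating one by `lipNatMod_PhiA2_dom`, the others by `Δ ≥ −m+1` and a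
coefficient ratio in `2ℤ₂`. [cite: Lai2025TwoAdicZeta, Lemma 6.2 (proof: (eqn_dominating_term) and (eqn_other_terms))] -/
theorem lipNatMod_PsiTermA (s : ℕ) {δ : ℕ} {m : ℕ} (hm : 2 ≤ m) {i : ℕ} (hi : i ∈ range (s + 1)) {ι : ℕ → ℕ}
    (hι : ι ∈ (Icc 1 (2 ^ m - 1)).piAntidiag i) :
    LipNatMod 2 m ((2 : ℝ) ^ (m - 2)) (PsiTermA s δ m i ι) := by
  have hm1 : 1 ≤ m := by omega
  have hi' : i ≤ s := by have := mem_range.1 hi; omega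
  have hc : ((cdom s m : ℕ) : ℚ_[2]) ≠ 0 := by exact_mod_cast cdom_ne_zero s hm1
  by_cases hne : i = s ∧ ι = iotaDom s m
  · obtain ⟨his, hιd⟩ := hne
    subst hιd
    rw [his]
    have e : PsiTermA s δ m s (iotaDom s m) = PhiA2 s δ (2 ^ m - 1) s (iotaDom s m) := by
      funext j
      rw [PsiTermA, show ((coefN s (2 ^ m - 1) s (iotaDom s m) : ℕ) : ℚ_[2]) = ((cdom s m : ℕ) : ℚ_[2]) from rfl,
        inv_mul_cancel₀ hc, one_mul]
    rw [e]; exact lipNatMod_PhiA2_dom s δ hm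
  · have hL := lipNat_PhiA2 s δ m i ι
    have h := (lipNatMod_of_lipNat hL.1 m).const_mul
      (((cdom s m : ℕ) : ℚ_[2])⁻¹ * ((coefN s (2 ^ m - 1) i ι : ℕ) : ℚ_[2]))
    refine h.mono ?_
    have hc0 : 0 < ‖((cdom s m : ℕ) : ℚ_[2])‖ := norm_pos_iff.2 hc
    have hq := norm_coefN_le_half s hm hi' hι hne
    rw [norm_mul, norm_inv]
    calc ‖((cdom s m : ℕ) : ℚ_[2])‖⁻¹ * ‖((coefN s (2 ^ m - 1) i ι : ℕ) : ℚ_[2])‖ * (2 : ℝ) ^ (m - 1)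
        ≤ ‖((cdom s m : ℕ) : ℚ_[2])‖⁻¹ * (‖((cdom s m : ℕ) : ℚ_[2])‖ / 2) * (2 : ℝ) ^ (m - 1) := by gcongr
      _ = (2 : ℝ) ^ (m - 2) := by
          field_simp
          rw [show m - 1 = (m - 2) + 1 by omega, pow_succ]; ring

/-- **`Δ_m(Ψ) ≥ −m+2`.** [cite: Lai2025TwoAdicZeta, Lemma 6.2 (proof: Lemma 2.5 (2) applied to (eqn_Sum))] -/
theorem lipNatMod_PsiA (s δ : ℕ) {m : ℕ} (hm : 2 ≤ m) : LipNatMod 2 m ((2 : ℝ) ^ (m - 2)) (PsiA s δ m) := by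
  have hM : (0 : ℝ) ≤ (2 : ℝ) ^ (m - 2) := by positivity
  refine LipNatMod.finset_sum (F := fun i j => ∑ ι ∈ (Icc 1 (2 ^ m - 1)).piAntidiag i, PsiTermA s δ m i ι j) _ hM
    fun i hi => ?_
  exact LipNatMod.finset_sum (F := fun ι j => PsiTermA s δ m i ι j) _ hM fun ι hι => lipNatMod_PsiTermA s hm hi hι

/-- `‖(coef/coef_dom)·PhiA2(j)‖₂ ≤ ‖PhiA2(j)‖₂`. [cite: Lai2025TwoAdicZeta, Lemma 6.2 (proof)] -/
theorem norm_PsiTermA_le (s δ : ℕ) {m : ℕ} (hm : 2 ≤ m) {i : ℕ} (hi : i ∈ range (s + 1)) {ι : ℕ → ℕ}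
    (hι : ι ∈ (Icc 1 (2 ^ m - 1)).piAntidiag i) (j : ℕ) :
    ‖PsiTermA s δ m i ι j‖ ≤ ‖PhiA2 s δ (2 ^ m - 1) i ι j‖ := by
  have hi' : i ≤ s := by have := mem_range.1 hi; omega
  have hc0 : 0 < ‖((cdom s m : ℕ) : ℚ_[2])‖ := norm_pos_iff.2 (by exact_mod_cast cdom_ne_zero s (by omega))
  rw [PsiTermA, norm_mul]
  refine mul_le_of_le_one_left (norm_nonneg _) ?_
  rw [norm_mul, norm_inv]
  calc ‖((cdom s m : ℕ) : ℚ_[2])‖⁻¹ * ‖((coefN s (2 ^ m - 1) i ι : ℕ) : ℚ_[2])‖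
      ≤ ‖((cdom s m : ℕ) : ℚ_[2])‖⁻¹ * ‖((cdom s m : ℕ) : ℚ_[2])‖ := by
        gcongr; exact norm_coefN_le s hm hi' hι
    _ = 1 := inv_mul_cancel₀ hc0.ne'

/-- Off the dominating index `‖(coef/coef_dom)·PhiA2(j)‖₂ ≤ ½`. [cite: Lai2025TwoAdicZeta, Lemma 6.2 (proof: (eqn_other_terms))] -/
theorem norm_PsiTermA_le_half (s δ : ℕ) {m : ℕ} (hm : 2 ≤ m) {i : ℕ} (hi : i ≤ s) {ι : ℕ → ℕ}
    (hι : ι ∈ (Icc 1 (2 ^ m - 1)).piAntidiag i) (hne : ¬ (i = s ∧ ι = iotaDom s m)) (j : ℕ) :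
    ‖PsiTermA s δ m i ι j‖ ≤ 2⁻¹ := by
  have hc0 : 0 < ‖((cdom s m : ℕ) : ℚ_[2])‖ := norm_pos_iff.2 (by exact_mod_cast cdom_ne_zero s (by omega))
  rw [PsiTermA, norm_mul, norm_mul, norm_inv]
  calc ‖((cdom s m : ℕ) : ℚ_[2])‖⁻¹ * ‖((coefN s (2 ^ m - 1) i ι : ℕ) : ℚ_[2])‖ * ‖PhiA2 s δ (2 ^ m - 1) i ι j‖
      ≤ ‖((cdom s m : ℕ) : ℚ_[2])‖⁻¹ * (‖((cdom s m : ℕ) : ℚ_[2])‖ / 2) * 1 := by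
        gcongr
        · exact norm_coefN_le_half s hm hi hι hne
        · exact norm_PhiA2_le_one _ _ _ _ _ _
    _ = 2⁻¹ := by field_simp

/-- **The Riemann-sum terms `k ≥ 1`:** `‖Ψ(j)‖₂ ≤ ¼` for `1 ≤ j < 2^m`. [cite: Lai2025TwoAdicZeta, Lemma 6.2 (proof of (eqn_5_1))] -/
theorem norm_PsiA_le_quarter (s δ : ℕ) {m : ℕ} (hm : 2 ≤ m) {j : ℕ} (hj1 : 1 ≤ j) (hj : j < 2 ^ m) :
    ‖PsiA s δ m j‖ ≤ 4⁻¹ := by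
  refine IsUltrametricDist.norm_sum_le_of_forall_le_of_nonneg (by norm_num) fun i hi => ?_
  refine IsUltrametricDist.norm_sum_le_of_forall_le_of_nonneg (by norm_num) fun ι hι => ?_
  exact (norm_PsiTermA_le s δ hm hi hι j).trans
    (norm_PhiA2_le_quarter s δ (by omega) (by have := mem_range.1 hi; omega) ι hj1 hj)

/-- **The Riemann-sum term `k = 0`:** `‖Ψ(0)‖₂ = 1` — the dominating term is a unit, all others lie in `2ℤ₂`.
[cite: Lai2025TwoAdicZeta, Lemma 6.2 (proof of (eqn_5_1) and (eqn_other_terms))] -/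
theorem norm_PsiA_zero (s δ : ℕ) {m : ℕ} (hm : 2 ≤ m) : ‖PsiA s δ m 0‖ = 1 := by
  classical
  have hm1 : 1 ≤ m := by omega
  have hc : ((cdom s m : ℕ) : ℚ_[2]) ≠ 0 := by exact_mod_cast cdom_ne_zero s hm1
  have hR1 : ‖∑ i ∈ range s, ∑ ι ∈ (Icc 1 (2 ^ m - 1)).piAntidiag i, PsiTermA s δ m i ι 0‖ ≤ 2⁻¹ := by
    refine IsUltrametricDist.norm_sum_le_of_forall_le_of_nonneg (by norm_num) fun i hi => ?_
    refine IsUltrametricDist.norm_sum_le_of_forall_le_of_nonneg (by norm_num) fun ι hι => ?_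
    have hi' := mem_range.1 hi
    exact norm_PsiTermA_le_half s δ hm hi'.le hι (fun h => absurd h.1 (by omega)) 0
  have hR2 : ‖∑ ι ∈ ((Icc 1 (2 ^ m - 1)).piAntidiag s).erase (iotaDom s m), PsiTermA s δ m s ι 0‖ ≤ 2⁻¹ := by
    refine IsUltrametricDist.norm_sum_le_of_forall_le_of_nonneg (by norm_num) fun ι hι => ?_
    have hι' := mem_erase.1 hι
    exact norm_PsiTermA_le_half s δ hm le_rfl hι'.2 (fun h => hι'.1 h.2) 0
  have hdom : ‖PsiTermA s δ m s (iotaDom s m) 0‖ = 1 := by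
    rw [PsiTermA, show ((coefN s (2 ^ m - 1) s (iotaDom s m) : ℕ) : ℚ_[2]) = ((cdom s m : ℕ) : ℚ_[2]) from rfl,
      inv_mul_cancel₀ hc, one_mul, norm_PhiA2_dom_zero s δ hm1]
  have hsplit : ∑ ι ∈ (Icc 1 (2 ^ m - 1)).piAntidiag s, PsiTermA s δ m s ι 0 =
      PsiTermA s δ m s (iotaDom s m) 0 +
        ∑ ι ∈ ((Icc 1 (2 ^ m - 1)).piAntidiag s).erase (iotaDom s m), PsiTermA s δ m s ι 0 := by
    rw [← add_sum_erase _ _ (iotaDom_mem s hm1)]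
  rw [PsiA, sum_range_succ, hsplit]
  have hin : ‖PsiTermA s δ m s (iotaDom s m) 0 +
      ∑ ι ∈ ((Icc 1 (2 ^ m - 1)).piAntidiag s).erase (iotaDom s m), PsiTermA s δ m s ι 0‖ = 1 := by
    have hne : ‖PsiTermA s δ m s (iotaDom s m) 0‖ ≠
        ‖∑ ι ∈ ((Icc 1 (2 ^ m - 1)).piAntidiag s).erase (iotaDom s m), PsiTermA s δ m s ι 0‖ := by
      rw [hdom]; exact ne_of_gt (hR2.trans_lt (by norm_num))
    rw [Padic.add_eq_max_of_ne hne, hdom, max_eq_left (hR2.trans (by norm_num))]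
  have hne' : ‖∑ i ∈ range s, ∑ ι ∈ (Icc 1 (2 ^ m - 1)).piAntidiag i, PsiTermA s δ m i ι 0‖ ≠
      ‖PsiTermA s δ m s (iotaDom s m) 0 +
        ∑ ι ∈ ((Icc 1 (2 ^ m - 1)).piAntidiag s).erase (iotaDom s m), PsiTermA s δ m s ι 0‖ := by
    rw [hin]; exact ne_of_lt (hR1.trans_lt (by norm_num))
  rw [Padic.add_eq_max_of_ne hne', hin, max_eq_right (hR1.trans (by norm_num))]

/-- **`‖Σ_{k<2^m} Ψ(k)‖₂ = 1`.** [cite: Lai2025TwoAdicZeta, Lemma 6.2 (proof of (eqn_5_1))] -/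
theorem norm_sum_PsiA_eq_one (s δ : ℕ) {m : ℕ} (hm : 2 ≤ m) : ‖∑ j ∈ range (2 ^ m), PsiA s δ m j‖ = 1 := by
  have h2m : 1 ≤ 2 ^ m := Nat.one_le_two_pow
  rw [← Finset.sum_range_add_sum_Ico _ h2m, Finset.sum_range_one]
  have hrest : ‖∑ k ∈ Ico 1 (2 ^ m), PsiA s δ m k‖ ≤ 4⁻¹ :=
    IsUltrametricDist.norm_sum_le_of_forall_le_of_nonneg (by norm_num) fun k hk =>
      norm_PsiA_le_quarter s δ hm (mem_Ico.1 hk).1 (mem_Ico.1 hk).2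
  have hne : ‖PsiA s δ m 0‖ ≠ ‖∑ k ∈ Ico 1 (2 ^ m), PsiA s δ m k‖ := by
    rw [norm_PsiA_zero s δ hm]; exact ne_of_gt (hrest.trans_lt (by norm_num))
  rw [Padic.add_eq_max_of_ne hne, norm_PsiA_zero s δ hm, max_eq_left (hrest.trans (by norm_num))]

/-- The Riemann sum of `Ψ` at level `m` has norm `2^m` (`δ ≤ 1`). [cite: Lai2025TwoAdicZeta, Lemma 6.2 (proof: (eqn_5_1))] -/
theorem norm_volkenbornSum_FzA (s : ℕ) {δ : ℕ} (hδ : δ ≤ 1) {m : ℕ} (hm : 2 ≤ m) :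
    ‖volkenbornSum 2 (FzA s δ m) m‖ = (2 : ℝ) ^ m := by
  rw [volkenbornSum_def, norm_smul, norm_inv, norm_pow, Padic.norm_p, inv_pow, inv_inv]
  have e : ∑ k ∈ range (2 ^ m), FzA s δ m (k : ℤ_[2]) = ∑ k ∈ range (2 ^ m), PsiA s δ m k :=
    sum_congr rfl fun k _ => FzA_natCast s hδ (by omega) k
  push_cast
  rw [e, norm_sum_PsiA_eq_one s δ hm, mul_one]

/-- **Lemma 6.2 (exact valuation), general `s`:** for `n = 2^m − 1`, `m ≥ 2`, `δ ≤ 1`,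
`‖S_n‖₂ = ‖s!·2^{(9s+18)n+4s+8}·binom(s+2,s)·n!²·((k₀−1)!(n−k₀)!)^s‖₂ · 2^m`, i.e.
`v₂(S_n) = (9s+18)n + 4s + 8 + v₂(s!binom(s+2,s)) + 2v₂(n!) + s·v₂((k₀−1)!(n−k₀)!) − m`
(`= (10s+20)n − (2s+3)m + 5s + v₂((s+2)!) + 7` with `v₂(n!) = n − m`, `v₂((2^{m−1}−1)!) = (n+1)/2 − m`; with
`v₂(d_n) = m−1`, `v₂(Φ_n) = 0` this is the printed `v₂(Φ_n^{−s−2}d_n^{3s+5}S_n) = (10s+20)n + (s+2)m + 2s + v₂((s+2)!) + 2`).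
Proof as printed: `Δ_m(Ψ) ≥ −m+2`, so `∫Ψ ≡ 2^{−m}Σ_{k<2^m}Ψ(k) (mod 2^{−m+1})`, and the sum is a `2`-adic unit.
[cite: Lai2025TwoAdicZeta, Lemma 6.2] -/
theorem norm_Ss_mersenne (s : ℕ) {δ : ℕ} (hδ : δ ≤ 1) {m : ℕ} (hm : 2 ≤ m) :
    ‖Ss s δ (2 ^ m - 1)‖ = ‖KA s m‖ * (2 : ℝ) ^ m := by
  have hm1 : 1 ≤ m := by omega
  have hM0 : (0 : ℝ) ≤ (2 : ℝ) ^ (m - 2) := by positivity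
  have hLip : LipNatMod 2 m ((2 : ℝ) ^ (m - 2)) (fun k : ℕ => FzA s δ m (k : ℤ_[2])) := by
    intro k h
    show ‖FzA s δ m ((k + 2 ^ m * h : ℕ) : ℤ_[2]) - FzA s δ m ((k : ℕ) : ℤ_[2])‖ ≤
      (2 : ℝ) ^ (m - 2) * ‖((2 ^ m * h : ℕ) : ℚ_[2])‖
    rw [FzA_natCast s hδ hm1, FzA_natCast s hδ hm1]
    exact lipNatMod_PsiA s δ hm k h
  have hI := tendsto_volkenbornSum_FzA s hδ m
  have hclose := norm_sub_volkenbornSum_le_of_lipNatMod (p := 2) hM0 hLip hI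
  have hSm := norm_volkenbornSum_FzA s hδ hm
  have hlt : ‖(KA s m)⁻¹ * Ss s δ (2 ^ m - 1) - volkenbornSum 2 (FzA s δ m) m‖ < ‖volkenbornSum 2 (FzA s δ m) m‖ := by
    rw [hSm]
    have h1 : ‖(KA s m)⁻¹ * Ss s δ (2 ^ m - 1) - volkenbornSum 2 (FzA s δ m) m‖ ≤ (2 : ℝ) ^ (m - 1 : ℕ) := by
      refine hclose.trans (le_of_eq ?_)
      push_cast
      rw [show m - 1 = (m - 2) + 1 by omega, pow_succ]; ring
    exact h1.trans_lt (pow_lt_pow_right₀ (by norm_num) (by omega))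
  have hkey : ‖(KA s m)⁻¹ * Ss s δ (2 ^ m - 1)‖ = (2 : ℝ) ^ m := by
    have e : (KA s m)⁻¹ * Ss s δ (2 ^ m - 1) =
        ((KA s m)⁻¹ * Ss s δ (2 ^ m - 1) - volkenbornSum 2 (FzA s δ m) m) + volkenbornSum 2 (FzA s δ m) m := by ring
    rw [e, Padic.add_eq_max_of_ne (ne_of_lt hlt), max_eq_right hlt.le, hSm]
  rw [norm_mul, norm_inv] at hkey
  have hc : ‖KA s m‖ ≠ 0 := norm_ne_zero_iff.2 (KA_ne_zero s hm1)
  field_simp at hkey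
  linarith [hkey]

/-- **Lemma 6.2 ("In particular `Φ_n^{−s−2}d_n^{3s+5}S_n ≠ 0`")**, general `s`, along `n = 2^m − 1`, `m ≥ 2` (`δ ≤ 1`):
**`S_n ≠ 0`**. [cite: Lai2025TwoAdicZeta, Lemma 6.2 ("In particular, Φ_n^{−s−2}d_n^{3s+5}S_n ≠ 0")] -/
theorem Ss_mersenne_ne_zero (s : ℕ) {δ : ℕ} (hδ : δ ≤ 1) {m : ℕ} (hm : 2 ≤ m) : Ss s δ (2 ^ m - 1) ≠ 0 := by
  intro h
  have h1 := norm_Ss_mersenne s hδ hm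
  rw [h, norm_zero] at h1
  have h2 : 0 < ‖KA s m‖ * (2 : ℝ) ^ m := mul_pos (norm_pos_iff.2 (KA_ne_zero s (by omega))) (by positivity)
  linarith

/-! ### The smallness bound `‖S_n‖₂ ≤ 2^{(2s+3)m − (10s+20)n − 5s − 8}` -/

/-- `‖K‖₂ ≤ 2^{−((9s+18)n+4s+8)}·‖n!‖₂²·‖F_{k₀}‖₂^s`. [cite: Lai2025TwoAdicZeta, Lemma 6.2 (proof: v₂ of the prefactors)] -/
theorem norm_KA_le (s : ℕ) {m : ℕ} (hm : 1 ≤ m) :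
    ‖KA s m‖ ≤ (2 : ℝ) ^ (-(((9 * s + 18) * (2 ^ m - 1) + 4 * s + 8 : ℕ) : ℤ)) *
      (‖(((2 ^ m - 1)! : ℕ) : ℚ_[2])‖ ^ 2 * ‖((Ffac (2 ^ m - 1) (2 ^ (m - 1)) : ℕ) : ℚ_[2])‖ ^ s) := by
  rw [KA, norm_mul, norm_mul, norm_two_pow, norm_cdom s hm]
  have h1 : ‖((s ! : ℕ) : ℚ_[2])‖ ≤ 1 := norm_natCast_le_one₂ _
  have h2 : ‖(((s + 2).choose s : ℕ) : ℚ_[2])‖ ≤ 1 := norm_natCast_le_one₂ _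
  set N := ‖(((2 ^ m - 1)! : ℕ) : ℚ_[2])‖
  set F := ‖((Ffac (2 ^ m - 1) (2 ^ (m - 1)) : ℕ) : ℚ_[2])‖
  set P := (2 : ℝ) ^ (-(((9 * s + 18) * (2 ^ m - 1) + 4 * s + 8 : ℕ) : ℤ))
  have hP : 0 ≤ P := by positivity
  calc ‖((s ! : ℕ) : ℚ_[2])‖ * P * (‖(((s + 2).choose s : ℕ) : ℚ_[2])‖ * N ^ 2 * F ^ s)
      ≤ 1 * P * (1 * N ^ 2 * F ^ s) := by gcongr
    _ = P * (N ^ 2 * F ^ s) := by ring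

/-- **The `2`-adic smallness of the linear forms**, general `s`, along `n = 2^m − 1` (`m ≥ 2`, `δ ≤ 1`):
`‖S_n‖₂ ≤ 2^{(2s+3)m − (10s+20)n − 5s − 8}` (printed: `|Φ_n^{−s−2}d_n^{3s+5}S_n|₂ = 2^{(−10s−20+o(1))n}`; here through
Legendre's `v₂(a!) ≥ a − ⌊log₂a⌋ − 1` for `n!` and `(k₀−1)!`).
[cite: Lai2025TwoAdicZeta, Lemma 6.2 ("|Φ_n^{−s−2}d_n^{3s+5}S_n|_2 = 2^{(−10s−20+o(1))n}")] -/
theorem norm_Ss_mersenne_le (s : ℕ) {δ : ℕ} (hδ : δ ≤ 1) {m : ℕ} (hm : 2 ≤ m) :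
    ‖Ss s δ (2 ^ m - 1)‖ ≤
      (2 : ℝ) ^ ((2 * s + 3) * (m : ℤ) - (10 * s + 20) * ((2 ^ m - 1 : ℕ) : ℤ) - 5 * s - 8) := by
  have hm1 : 1 ≤ m := by omega
  have h1m : 1 ≤ 2 ^ m := Nat.one_le_two_pow
  have hlog : Nat.log 2 (2 ^ m - 1) + 1 = m := by rw [log_two_mersenne' hm1]; omega
  have hF := norm_Ffac_middle_le hm
  have hK := norm_KA_le s hm1
  rw [norm_Ss_mersenne s hδ hm]
  obtain ⟨n, hn, hn'⟩ : ∃ n : ℕ, 2 ^ m - 1 = n ∧ ((2 : ℤ) ^ m) = n + 1 :=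
    ⟨2 ^ m - 1, rfl, by rw [Nat.cast_sub h1m]; push_cast; ring⟩
  rw [hn] at hF hK hlog ⊢
  rw [hn'] at hF
  have hfact : ‖((n ! : ℕ) : ℚ_[2])‖ ≤ (2 : ℝ) ^ ((m : ℤ) - n) := by
    have h := norm_factorial_le n
    rwa [hlog] at h
  have hN0 : 0 ≤ ‖((n ! : ℕ) : ℚ_[2])‖ := norm_nonneg _
  have hF0 : 0 ≤ ‖((Ffac n (2 ^ (m - 1)) : ℕ) : ℚ_[2])‖ := norm_nonneg _
  calc ‖KA s m‖ * (2 : ℝ) ^ m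
      ≤ (2 : ℝ) ^ (-(((9 * s + 18) * n + 4 * s + 8 : ℕ) : ℤ)) *
          (((2 : ℝ) ^ ((m : ℤ) - n)) ^ 2 * ((2 : ℝ) ^ (2 * (m : ℤ) - (n + 1))) ^ s) * (2 : ℝ) ^ m := by
        refine mul_le_mul_of_nonneg_right (hK.trans ?_) (by positivity)
        gcongr
    _ = (2 : ℝ) ^ ((2 * s + 3) * (m : ℤ) - (10 * s + 20) * (n : ℤ) - 5 * s - 8) := by
        rw [sq, ← zpow_natCast ((2 : ℝ) ^ (2 * (m : ℤ) - (n + 1))) s, ← zpow_mul, ← zpow_natCast (2 : ℝ) m]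
        simp only [← zpow_add₀ (two_ne_zero : (2 : ℝ) ≠ 0)]
        congr 1
        push_cast
        ring

end Literature.NumberTheory.Irrationality.Lai2025TwoAdic
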